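import Literature.MathematicalPhysics.QuantumFieldTheory.Balaban1983to89.B9Ineq368PPrimeDs
import Literature.MathematicalPhysics.QuantumFieldTheory.Balaban1983to89.B9Ineq386CommSum

/-!
# `Balaban1983to89.B9Ineq368CommSum` — B9 p. 403, (3.68)₃,₄ `|P′(A)D*|`, `|DP′(A)D*|`: the commutator device of
# `B9Ineq368PPrimeDs` §5 for the PRINTED FINITE SUM over the bonds of `st(x)` (`V′ = V⁰ + Σ_k V¹_k∇_k`, one commutator
# letter per difference letter) — the `G′`-side twin of `B9Ineq386CommSum`

statement-level skeleton of published theorems with citation tags; proofs where landed; nothing here is a claim about the Yang–Mills mass gap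

DOCFIX (cell `lit-balaban`, seat r06 gen 15, 2026-08-22; p37 `CITELOC-SWEEP-B4B9.md` §2b page-numeral slips, text layer re-read): (3.57) is p. 401 [PDF 13] ((3.58)–(3.65) p. 402, (3.65)bis–(3.68) p. 403) — the locators of (3.57)–(3.67) in this file corrected accordingly (2 place(s)); declarations, statements and proofs byte-identical to the tree copy of record (p261232).

CITATION HEADER (lean-in-tree rule).  T. Bałaban, *Propagators for lattice gauge theories in a background field*, Commun.
Math. Phys. **99** (1985) 389–434 [Balaban1985BackgroundPropagators] (cell paper B9; `paper:balaban1985-cmp99-background-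
propagators`, journal page = PDF page + 388): p. 403 [PDF 15] (3.68) («The remainder can be written explicitly with the help
of the formula (3.65), and the estimates above allow to prove the following bounds |P′(A; x,x′)|, |(DP′(A))_μ(x,x′)|,
|(P′(A)D*)_ν(x,x′)|, |(DP′(A)D*)_{μν}(x,x′)| ≦ O(1)α₁[1, (Lʲη)⁻¹, (Lʲη)⁻¹, (Lʲη)⁻²](L^{j′}η)^{−d}e^{−(1/2)δ₀d(y,y′)}»), p. 402
[PDF 14] (3.60)–(3.65), p. 400 [PDF 12] (3.52) («(V′₁(A)λ)(x) = Σ_{b∈st(x)} i[A′(b), (D_Uλ)(b)] + …» — a SUM over the `2d`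
bonds of `st(x)`), p. 396 [PDF 8] (3.37), p. 397–398 [PDF 9–10] (3.42) and the remarks after Theorem 3.1; [4] = T. Bałaban,
*Propagators and renormalization transformations for lattice gauge theories. II*, Commun. Math. Phys. **96** (1984)
223–250 [Balaban1984PropagatorsII], (2.51)–(2.55) p. 232 («A summation preserves it also»), Lemma 2.1 p. 234.  Cell
`lit-balaban`, seat r06 (B9 fold owner) gen 8, fourth file of the gen; SKELETON rows **B9.Eq3.68** (entries 3–4) × **B9.Eq3.60
/ B9.Eq3.50**.  Continuation of the same seat's `B9Ineq368PPrimeDs` (gen 7: `hasMajorant_GVEDs`, `hasMajorant_pPrime_words_Ds`,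
`ineq368_op_Ds`, `ineq368_op_DDs`, §5 `…_of_comm`; USED BY NAME) and `B9Ineq386CommSum` (gen 8: `divForm_of_gradForm_sum`,
`hasMajorant_sum_const`, `hasMajorant_C₃_of_comm_sum`; USED BY NAME).

WHY THIS FILE.  `B9Ineq368PPrimeDs` reads the first-order operator `V′(A)` of (3.60) through ONE difference letter (`V′ =
∇♯·B″ + C″`, resp. `V′ = V⁰ + V¹∇` plus ONE commutator letter in §5).  The concrete `V′₁(A)` of (3.52) is a sum over the `2d`
bonds of `st(x)` — one difference letter `∇_μ` / `∇*_μ` per bond (`B9Eq352DivForm.V1p_eq_divForm`, `commPart`) —, and the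
same seat's `B9Eq352DivFormLetters.hasMajorant_comm_forward/backward` proves the commutator hypothesis PER BOND.  The only
place where `B9Ineq368PPrimeDs` consumes the structure of `V′` is the bracket `G′V′G′(U′U)D*` of word 5 (`hasMajorant_GVEDs`);
this file (i) derives that bracket for the finite-sum divergence form from `hasMajorant_GVEDs` applied letter by letter
([4] p. 232 «A summation preserves it also»), (ii) re-threads the five words with the bracket AS A HYPOTHESIS, and (iii)
assembles (3.68)₃,₄ for the finite-sum gradient form with one commutator letter per difference letter — the `G′`-side
twin of `B9Ineq386CommSum`, with the constant `κ₃₆₈ᴰ` of gen 7 UNCHANGED once `Σ_k c_{B,k} ≦ c_B` (and `c_C + Σ_k c_{M,k}`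
for `c_C`).

WHAT THIS FILE PROVES (theorems only; 0 sorry; no definitions, no `Prop` placeholders; standard axioms).  SETTING as in
`B9Ineq368PPrimeDs`.
* §1 **`hasMajorant_GVEDs_sum`** — word 5's bracket for `V′ = Σ_{k∈s} ∇♯_k·B″_k + C″`: `G′V′G′(U′U)D* ≺ α₁B_{E3}Λ⁴c²(B_{G3}c_B
  + B_Gc_C)·Lʲη·e^{−ρd}` given `B″_k ≺ c_{B,k}α₁(Lʲη)⁻¹e^{−δd}`, `Σ_k c_{B,k} ≦ c_B`, `G′∇♯_k ≺ B_{G3}Lʲη e^{−δd}` per letter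
  (from `hasMajorant_GVEDs` at `(B″_k, 0)` per `k` and at `(0, C″)`, summed).
* §2 **`hasMajorant_pPrime_words_Ds_of_bracket`** — gen 7's five words of `P′(A)·D*` with the word-5 bracket entered as the
  hypothesis `hB5` (every other letter verbatim); **`ineq368_op_Ds_of_bracket`**, **`ineq368_op_DDs_of_bracket`** — (3.68)₃,₄
  in operator form from the bracket.
* §3 **`ineq368_op_Ds_sum`**, **`ineq368_op_DDs_sum`** — (3.68)₃,₄ for the finite-sum DIVERGENCE form; **`ineq368_op_Ds_of_comm_sum`**,
  **`ineq368_op_DDs_of_comm_sum`** — (3.68)₃,₄ for the finite-sum GRADIENT form `V′ = V⁰ + Σ_k V¹_k∇_k` with the (3.61)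
  sizes, one commutator letter `[V¹_k, ∇_k] ≺ c_{M,k}α₁(Lʲη)⁻²e^{−δd}` and one entry `G′(U)∇_k ≺ B_{G3}Lʲη e^{−δd}` per
  difference letter: `P′(A)·D* ≺ κ₃₆₈ᴰ(c_C + Σ_kc_{M,k} for c_C)·α₁·(Lʲη)⁻¹·e^{−ρd}`, `D·P′(A)·D* ≺ κ₃₆₈ᴰ(B_X = B_D; …)·α₁·
  (Lʲη)⁻²·e^{−ρd}` — the statements of `B9Ineq368PPrimeDs.ineq368_op_Ds_of_comm`/`…_DDs_of_comm` with `Σ_k` throughout.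

HONEST SCOPE / NOT CLAIMED.  As `B9Ineq368PPrimeDs` (operator form; the (3.68) entries 1–2 and all other letters are
gen 6/7's; the divergence/gradient forms are readings of (3.60)/(3.52), whose concrete per-bond letters are
`B9Eq352DivForm`/`B9Eq352DivFormLetters`); nothing about the concrete `V′` is asserted here; the `hComm k` letters are
hypotheses of the printed (3.37) shape, available as theorems for the coordinate-conjugated concrete letters of (3.52)
(`B9Eq352DivFormLetters.hasMajorant_comm_forward/backward`, finite-dimensional `𝔸`).  Value = the printed `Σ_{b∈st(x)}`
made explicit on the `G′`-side of the Sect. B chain; NOT summit progress.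

RELATED IN THE TREE, NOT DUPLICATED (searched 2026-08-21: `ls Balaban1983to89 | grep -i 'CommSum\|368'` =
`B9Ineq368PPrime`, `B9Ineq368PPrimeDs`, `B9Ineq386CommSum`): the one-letter theorems of `B9Ineq368PPrimeDs` are USED BY
NAME (`hasMajorant_GVEDs`, `kappa368Ds`, `transfer_two`) or re-threaded with one hypothesis replaced (§2, said in each
docstring); `B9Ineq386CommSum` is the `G`-side twin ((3.85), (3.42)₃).
-/

noncomputable section

namespace Literature.MathematicalPhysics.QuantumFieldTheory.Balaban1983to89.B9Ineq368CommSum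

open Literature.MathematicalPhysics.QuantumFieldTheory.Balaban1983to89
open Literature.MathematicalPhysics.QuantumFieldTheory.Balaban1983to89.B6RandomWalk (HasMajorant BlockSupp
  hasMajorant_mono hasMajorant_mul hasMajorant_add hasMajorant_zero Triangle254 Ineq261)
open Literature.MathematicalPhysics.QuantumFieldTheory.Balaban1983to89.B9Thm34Ext (toB6)
open Literature.MathematicalPhysics.QuantumFieldTheory.Balaban1983to89.B9Ineq347 (ScaleTransfer)
open Literature.MathematicalPhysics.QuantumFieldTheory.Balaban1983to89.B9Ineq366CPrime (hasMajorant_comp_decay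
  hasMajorant_comp_decay_left1 hasMajorant_comp_decay_right1 hasMajorant_rate_mono hasMajorant_local_mul
  hasMajorant_mul_local)
open Literature.MathematicalPhysics.QuantumFieldTheory.Balaban1983to89.B9Ineq368PPrime (hasMajorant_neg hasMajorant_sub
  hasMajorant_local_add hasMajorant_word5 transfers_word scaleTransfer_mul scaleTransfer_exp_mono scaleTransfer_const_mono
  kappa349 kappa368)
open Literature.MathematicalPhysics.QuantumFieldTheory.Balaban1983to89.B9Ineq368PPrimeDs (kappa368Ds transfer_two
  hasMajorant_GVEDs)
open Literature.MathematicalPhysics.QuantumFieldTheory.Balaban1983to89.B9Ineq386CommSum (hasMajorant_sum_const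
  divForm_of_gradForm_sum hasMajorant_C₃_of_comm_sum)

variable {g : B9.Geometry} [Fintype g.Site] [DecidableEq g.Site] {R : ℝ} {H : Prop} {W : Type} {K : Type}

/-! ## §1  The sub-word `G′(U)·V′(A)·G′(U′U)·D*` for the finite-sum divergence form of `V′` -/

omit [DecidableEq g.Site] in
/-- **Word 5's bracket for `V′ = Σ_{k∈s} ∇♯_k·B″_k + C″`** (one difference letter per bond of `st(x)`, as (3.52) prints
`V′₁`): with `B″_k ≺ c_{B,k}α₁(Lʲη)⁻¹e^{−δd}` (`Σ_k c_{B,k} ≦ c_B`), `C″ ≺ c_Cα₁(Lʲη)⁻²e^{−δd}`, (3.42)₁ for `G′(U)`, (3.42)₃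
for each letter `G′(U)∇♯_k ≺ B_{G3}Lʲη e^{−δd}` and for `G′(U′U)D* ≺ B_{E3}Lʲη e^{−δd}`, the scale transfers and Lemma 2.1
of [4]: `G′V′G′(U′U)D* ≺ α₁B_{E3}Λ⁴c²(B_{G3}c_B + B_Gc_C)·Lʲη·e^{−ρd}` for `ρ + 2(2α+β)δ₀ ≦ δ` — the conclusion of
`B9Ineq368PPrimeDs.hasMajorant_GVEDs` unchanged, obtained from it letter by letter and summed.
[cite: Balaban1985BackgroundPropagators, (3.68) p.403 + (3.60)–(3.61) p.402 + (3.52) p.400 + (3.42) p.397 + p.398 remarks; Balaban1984PropagatorsII, Lemma 2.1 p.234 + (2.52)–(2.55) p.232] -/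
theorem hasMajorant_GVEDs_sum (blk : W → g.Site) (d : ℕ) (s : Finset K) (δ₀ δ α β ρ Λ BG BG3 BE3 cB cC α₁ : ℝ)
    (cBk : K → ℝ)
    (hBG : 0 ≤ BG) (hBG3 : 0 ≤ BG3) (hBE3 : 0 ≤ BE3) (hcC : 0 ≤ cC) (hα₁ : 0 ≤ α₁) (hΛ : 1 ≤ Λ)
    (hρ : 0 ≤ ρ) (hα : 0 ≤ α) (hβ : 0 ≤ β) (hδ₀ : 0 ≤ δ₀) (hr : ρ + 2 * ((2 * α + β) * δ₀) ≤ δ)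
    (hcBk : ∀ k ∈ s, 0 ≤ cBk k) (hsum : ∑ k ∈ s, cBk k ≤ cB)
    (hdnn : ∀ a b : g.Site, 0 ≤ g.dist a b) (htri : Triangle254 (toB6 g R H)) (hlen : ∀ y : g.Site, 0 < g.len y)
    (h261 : Ineq261 d (toB6 g R H) δ₀ β)
    (hT1 : ScaleTransfer g δ₀ α Λ (fun a => g.len a)) (hT1i : ScaleTransfer g δ₀ α Λ (fun a => (g.len a)⁻¹))
    (hT2i : ScaleTransfer g δ₀ α Λ (fun a => (g.len a ^ 2)⁻¹))
    {G E Ds V Cpp : Module.End ℝ (W → ℝ)} {Dv Bpp : K → Module.End ℝ (W → ℝ)}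
    (hV : V = ∑ k ∈ s, Dv k * Bpp k + Cpp)
    (hG : HasMajorant (g := toB6 g R H) blk G (fun a b => BG * g.len a ^ 2 * Real.exp (-(δ * g.dist a b))))
    (hGDv : ∀ k ∈ s, HasMajorant (g := toB6 g R H) blk (G * Dv k)
      (fun a b => BG3 * g.len a * Real.exp (-(δ * g.dist a b))))
    (hEDs : HasMajorant (g := toB6 g R H) blk (E * Ds) (fun a b => BE3 * g.len a * Real.exp (-(δ * g.dist a b))))
    (hBpp : ∀ k ∈ s, HasMajorant (g := toB6 g R H) blk (Bpp k)
      (fun a b => cBk k * α₁ * (g.len a)⁻¹ * Real.exp (-(δ * g.dist a b))))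
    (hCpp : HasMajorant (g := toB6 g R H) blk Cpp
      (fun a b => cC * α₁ * (g.len a ^ 2)⁻¹ * Real.exp (-(δ * g.dist a b)))) :
    HasMajorant (g := toB6 g R H) blk (G * V * E * Ds)
      (fun a b => (α₁ * BE3 * Λ ^ 4 * B6.c1 d δ₀ β ^ 2 * (BG3 * cB + BG * cC)) * g.len a *
        Real.exp (-(ρ * g.dist a b))) := by
  set c : ℝ := B6.c1 d δ₀ β with hc_def
  have hc0 : 0 ≤ c := B6RandomWalk.c1_nonneg d δ₀ β
  have hw1 : ∀ a : g.Site, 0 ≤ g.len a := fun a => (hlen a).le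
  -- the zero letters (any non-negative majorant)
  have h0GD : HasMajorant (g := toB6 g R H) blk (G * (0 : Module.End ℝ (W → ℝ)))
      (fun a b => BG3 * g.len a * Real.exp (-(δ * g.dist a b))) := by
    rw [mul_zero]
    exact hasMajorant_mono (g := toB6 g R H) blk (hasMajorant_zero (g := toB6 g R H) blk) fun a b => by
      have := hw1 a; positivity
  have h0B : HasMajorant (g := toB6 g R H) blk (0 : Module.End ℝ (W → ℝ))
      (fun a b => 0 * α₁ * (g.len a)⁻¹ * Real.exp (-(δ * g.dist a b))) :=
    hasMajorant_mono (g := toB6 g R H) blk (hasMajorant_zero (g := toB6 g R H) blk) fun a b => by simp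
  have h0C : HasMajorant (g := toB6 g R H) blk (0 : Module.End ℝ (W → ℝ))
      (fun a b => 0 * α₁ * (g.len a ^ 2)⁻¹ * Real.exp (-(δ * g.dist a b))) :=
    hasMajorant_mono (g := toB6 g R H) blk (hasMajorant_zero (g := toB6 g R H) blk) fun a b => by simp
  -- one bracket per difference letter: V_k := ∇♯_k B″_k + 0
  have wk : ∀ k ∈ s, HasMajorant (g := toB6 g R H) blk (G * (Dv k * Bpp k) * E * Ds)
      (fun a b => (α₁ * BE3 * Λ ^ 4 * c ^ 2 * (BG3 * cBk k + BG * 0)) * (g.len a * Real.exp (-(ρ * g.dist a b)))) := by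
    intro k hk
    have hVk : Dv k * Bpp k = Dv k * Bpp k + 0 := (add_zero _).symm
    have h := hasMajorant_GVEDs (R := R) (H := H) blk d δ₀ δ α β ρ Λ BG BG3 BE3 (cBk k) 0 α₁ hBG hBG3 hBE3 (hcBk k hk)
      le_rfl hα₁ hΛ hρ hα hβ hδ₀ hr hdnn htri hlen h261 hT1 hT1i hT2i hVk hG (hGDv k hk) hEDs (hBpp k hk) h0C
    exact hasMajorant_mono (g := toB6 g R H) blk h fun a b => le_of_eq (by rw [← hc_def]; ring)
  have wsum := hasMajorant_sum_const (R := R) (H := H) blk s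
    (fun k => α₁ * BE3 * Λ ^ 4 * c ^ 2 * (BG3 * cBk k + BG * 0)) (fun a b => g.len a * Real.exp (-(ρ * g.dist a b))) wk
  -- the zeroth-order bracket: V_C := 0·0 + C″
  have hVC : Cpp = (0 : Module.End ℝ (W → ℝ)) * 0 + Cpp := by rw [mul_zero, zero_add]
  have wC := hasMajorant_GVEDs (R := R) (H := H) blk d δ₀ δ α β ρ Λ BG BG3 BE3 0 cC α₁ hBG hBG3 hBE3 le_rfl hcC hα₁ hΛ
    hρ hα hβ hδ₀ hr hdnn htri hlen h261 hT1 hT1i hT2i hVC hG h0GD hEDs h0B hCpp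
  have hall := hasMajorant_add (g := toB6 g R H) blk wsum wC
  have e : G * V * E * Ds = (∑ k ∈ s, G * (Dv k * Bpp k) * E * Ds) + G * Cpp * E * Ds := by
    rw [hV]
    simp only [mul_add, add_mul, Finset.mul_sum, Finset.sum_mul, mul_assoc]
  rw [e]
  refine hasMajorant_mono (g := toB6 g R H) blk hall fun a b => ?_
  have hS : (∑ k ∈ s, α₁ * BE3 * Λ ^ 4 * c ^ 2 * (BG3 * cBk k + BG * 0))
      ≤ α₁ * BE3 * Λ ^ 4 * c ^ 2 * (BG3 * cB) := by
    have h1 : (∑ k ∈ s, α₁ * BE3 * Λ ^ 4 * c ^ 2 * (BG3 * cBk k + BG * 0))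
        = α₁ * BE3 * Λ ^ 4 * c ^ 2 * BG3 * ∑ k ∈ s, cBk k := by
      rw [Finset.mul_sum]
      exact Finset.sum_congr rfl fun k _ => by ring
    rw [h1]
    have : 0 ≤ α₁ * BE3 * Λ ^ 4 * c ^ 2 * BG3 := by positivity
    nlinarith [mul_le_mul_of_nonneg_left hsum this]
  have hE : 0 ≤ g.len a * Real.exp (-(ρ * g.dist a b)) := mul_nonneg (hw1 a) (Real.exp_nonneg _)
  rw [← hc_def]
  nlinarith [mul_le_mul_of_nonneg_right hS hE]

/-! ## §2  The five words of `P′(A)·D*` with the word-5 bracket as a hypothesis; (3.68)₃,₄ from the bracket -/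

/-- **The five words of `P′(A)·D*`, word-5 bracket entered as a hypothesis** — gen 7's
`B9Ineq368PPrimeDs.hasMajorant_pPrime_words_Ds` VERBATIM except that the bracket `G′V′G′(U′U)D* ≺ α₁B_{E3}Λ⁴c²(B_{G3}c_B +
B_Gc_C)Lʲη e^{−ρd}` is the hypothesis `hB5` (there: derived from the one-letter divergence form by `hasMajorant_GVEDs`; here
supplied by §1 for the finite sum, or by anything else of that shape).  Majorant `κ₃₆₈ᴰ·α₁·w_X(Lʲη)⁻⁴Lʲη·e^{−ρd}`.
[cite: Balaban1985BackgroundPropagators, (3.68) p.403 + (3.57)–(3.67) pp.401–403 + Thm 3.1/3.2 pp.397–398; Balaban1984PropagatorsII, Lemma 2.1 p.234] -/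
theorem hasMajorant_pPrime_words_Ds_of_bracket (blk : W → g.Site) (d : ℕ)
    (δ₀ δ α β ρ Λ κQ cF cV κC BG BG3 BX BE BE3 Bc Bc' cB cC α₁ : ℝ) (wX : g.Site → ℝ)
    (hwX : ∀ a, 0 ≤ wX a) (hκQ : 0 ≤ κQ) (hcF : 0 ≤ cF) (hcV : 0 ≤ cV) (hκC : 0 ≤ κC) (hBG : 0 ≤ BG)
    (hBG3 : 0 ≤ BG3) (hBX : 0 ≤ BX) (hBE : 0 ≤ BE) (hBE3 : 0 ≤ BE3) (hBc : 0 ≤ Bc) (hBc' : 0 ≤ Bc') (hcB : 0 ≤ cB)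
    (hcC : 0 ≤ cC) (hα₁ : 0 ≤ α₁) (hΛ : 1 ≤ Λ) (hρ : 0 ≤ ρ) (hα : 0 ≤ α) (hβ : 0 ≤ β) (hδ₀ : 0 ≤ δ₀)
    (hr : ρ + 2 * ((2 * α + β) * δ₀) ≤ δ)
    (hdnn : ∀ a b : g.Site, 0 ≤ g.dist a b) (htri : Triangle254 (toB6 g R H)) (hlen : ∀ y : g.Site, 0 < g.len y)
    (h261 : Ineq261 d (toB6 g R H) δ₀ β)
    (hT1 : ScaleTransfer g δ₀ α Λ (fun a => g.len a)) (hT4 : ScaleTransfer g δ₀ α Λ (fun a => (g.len a ^ 4)⁻¹))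
    {X G E V Qs Q Qs' Q' F₂ F₂s Cinv Cinv' Cp Ds : Module.End ℝ (W → ℝ)}
    (h357 : Q' = Q + F₂) (h357s : Qs' = Qs + F₂s)
    (hX : HasMajorant (g := toB6 g R H) blk X (fun a b => BX * wX a * Real.exp (-(δ * g.dist a b))))
    (hEDs : HasMajorant (g := toB6 g R H) blk (E * Ds) (fun a b => BE3 * g.len a * Real.exp (-(δ * g.dist a b))))
    (hVE : HasMajorant (g := toB6 g R H) blk (V * E) (fun a b => cV * α₁ * BE * Real.exp (-(δ * g.dist a b))))
    (hB5 : HasMajorant (g := toB6 g R H) blk (G * V * E * Ds)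
      (fun a b => (α₁ * BE3 * Λ ^ 4 * B6.c1 d δ₀ β ^ 2 * (BG3 * cB + BG * cC)) * g.len a *
        Real.exp (-(ρ * g.dist a b))))
    (hQ : HasMajorant (g := toB6 g R H) blk Q (fun a b : g.Site => if a = b then κQ else 0))
    (hQs : HasMajorant (g := toB6 g R H) blk Qs (fun a b : g.Site => if a = b then κQ else 0))
    (hF : HasMajorant (g := toB6 g R H) blk F₂ (fun a b : g.Site => if a = b then cF * α₁ else 0))
    (hFs : HasMajorant (g := toB6 g R H) blk F₂s (fun a b : g.Site => if a = b then cF * α₁ else 0))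
    (hCinv : HasMajorant (g := toB6 g R H) blk Cinv
      (fun a b => Bc * (g.len a ^ 4)⁻¹ * Real.exp (-(δ * g.dist a b))))
    (hCinv' : HasMajorant (g := toB6 g R H) blk Cinv'
      (fun a b => Bc' * (g.len a ^ 4)⁻¹ * Real.exp (-(δ * g.dist a b))))
    (hCp : HasMajorant (g := toB6 g R H) blk Cp
      (fun a b => κC * α₁ * g.len a ^ 4 * Real.exp (-(δ * g.dist a b)))) :
    HasMajorant (g := toB6 g R H) blk
      (X * V * E * Qs' * Cinv' * Q' * (E * Ds) + X * F₂s * Cinv' * Q' * (E * Ds)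
        - X * Qs * (Cinv' * Cp * Cinv) * Q' * (E * Ds) + X * Qs * Cinv * F₂ * (E * Ds)
        + X * Qs * Cinv * Q * (G * V * E * Ds))
      (fun a b => kappa368Ds κQ cF cV κC BG BG3 BX BE BE3 Bc Bc' cB cC Λ (B6.c1 d δ₀ β) α₁ * α₁ *
        (wX a * ((g.len a ^ 4)⁻¹ * g.len a)) * Real.exp (-(ρ * g.dist a b))) := by
  -- constants and rates (as in gen 7's proof)
  set c : ℝ := B6.c1 d δ₀ β with hc_def
  have hc0 : 0 ≤ c := B6RandomWalk.c1_nonneg d δ₀ β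
  have hw1 : ∀ a : g.Site, 0 ≤ g.len a := fun a => (hlen a).le
  have hw4p : ∀ a : g.Site, 0 ≤ g.len a ^ 4 := fun a => by positivity
  have hw4 : ∀ a : g.Site, 0 ≤ (g.len a ^ 4)⁻¹ := fun a => inv_nonneg.mpr (hw4p a)
  have hΛ0 : 0 ≤ Λ := zero_le_one.trans hΛ
  have hεnn : 0 ≤ (2 * α + β) * δ₀ := by positivity
  set r : ℝ := ρ + (2 * α + β) * δ₀ with hr_def
  have hρr : ρ ≤ r := by rw [hr_def]; linarith
  have hr0 : 0 ≤ r := hρ.trans hρr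
  have hrδ : r + (2 * α + β) * δ₀ ≤ δ := by rw [hr_def]; linarith
  have hrδ' : r ≤ δ := by linarith
  have hρδ : ρ ≤ δ := hρr.trans hrδ'
  have hρr' : ρ + (2 * α + β) * δ₀ ≤ r := le_of_eq hr_def.symm
  have hαδ : 0 ≤ 2 * α * δ₀ := by positivity
  have hcFα : 0 ≤ cF * α₁ := mul_nonneg hcF hα₁
  have hcVα : 0 ≤ cV * α₁ * BE := by positivity
  -- scale transfers at exponent 2α, constant Λ²
  obtain ⟨t1, t41⟩ := transfers_word (g := g) hw1 hΛ hα hδ₀ hdnn hT1 hT4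
  have t4 : ScaleTransfer g δ₀ (2 * α) (Λ ^ 2) (fun a => (g.len a ^ 4)⁻¹) := transfer_two (g := g) hw4 hΛ hα hδ₀ hdnn hT4
  -- weakened letters
  have hXr := hasMajorant_rate_mono (R := R) (H := H) blk BX wX hBX hwX hrδ' hdnn hX
  have hEDsρ := hasMajorant_rate_mono (R := R) (H := H) blk BE3 (fun a => g.len a) hBE3 hw1 hρδ hdnn hEDs
  have hCinvr := hasMajorant_rate_mono (R := R) (H := H) blk Bc (fun a => (g.len a ^ 4)⁻¹) hBc hw4 hrδ' hdnn hCinv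
  have hCinv'r := hasMajorant_rate_mono (R := R) (H := H) blk Bc' (fun a => (g.len a ^ 4)⁻¹) hBc' hw4 hrδ' hdnn
    hCinv'
  have hVEr : HasMajorant (g := toB6 g R H) blk (V * E) (fun a b => cV * α₁ * BE * Real.exp (-(r * g.dist a b))) :=
    hasMajorant_mono (g := toB6 g R H) blk hVE fun a b =>
      mul_le_mul_of_nonneg_left (Real.exp_le_exp.mpr (by nlinarith [hdnn a b])) hcVα
  -- the block-local letters Q′(U′U), Q′*(U′U) of (3.57)
  have hQ' : HasMajorant (g := toB6 g R H) blk Q' (fun a b : g.Site => if a = b then κQ + cF * α₁ else 0) := by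
    rw [h357]; exact hasMajorant_local_add (R := R) (H := H) blk κQ (cF * α₁) hQ hF
  have hQs' : HasMajorant (g := toB6 g R H) blk Qs' (fun a b : g.Site => if a = b then κQ + cF * α₁ else 0) := by
    rw [h357s]; exact hasMajorant_local_add (R := R) (H := H) blk κQ (cF * α₁) hQs hFs
  have hκ' : 0 ≤ κQ + cF * α₁ := add_nonneg hκQ hcFα
  -- W1 = (X·V′E)·Qs′·Cinv′·Q′·(E D*)
  have hA1 : HasMajorant (g := toB6 g R H) blk (X * V * E)
      (fun a b => (BX * (cV * α₁ * BE) * B6.c1 d δ₀ β) * wX a * Real.exp (-(r * g.dist a b))) := by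
    rw [mul_assoc]
    exact hasMajorant_comp_decay_right1 (R := R) (H := H) blk d δ₀ (2 * α) β r δ BX (cV * α₁ * BE) wX hwX hBX
      hcVα hr0 hαδ hrδ hdnn htri h261 hX hVEr
  have hW1 := hasMajorant_word5 (R := R) (H := H) blk d δ₀ (2 * α) β ρ r (Λ ^ 2) (κQ + cF * α₁) (κQ + cF * α₁)
    (BX * (cV * α₁ * BE) * B6.c1 d δ₀ β) Bc' BE3 wX (fun a => (g.len a ^ 4)⁻¹) (fun a => g.len a) hwX hw4 hw1
    hκ' hκ' (by positivity) hBc' hBE3 (by positivity) hρ hρr' hdnn htri h261 t1 t41 hA1 hQs' hCinv'r hQ' hEDsρ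
  -- W2 = X·F′₂*·Cinv′·Q′·(E D*)
  have hW2 := hasMajorant_word5 (R := R) (H := H) blk d δ₀ (2 * α) β ρ r (Λ ^ 2) (cF * α₁) (κQ + cF * α₁)
    BX Bc' BE3 wX (fun a => (g.len a ^ 4)⁻¹) (fun a => g.len a) hwX hw4 hw1
    hcFα hκ' hBX hBc' hBE3 (by positivity) hρ hρr' hdnn htri h261 t1 t41 hXr hFs hCinv'r hQ' hEDsρ
  -- W3 = X·Q′*·(Cinv′·C′·Cinv)·Q′·(E D*)
  have u1 : HasMajorant (g := toB6 g R H) blk (Cp * Cinv)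
      (fun a b => (κC * α₁ * Bc * Λ ^ 2 * B6.c1 d δ₀ β) * (g.len a ^ 4 * (g.len a ^ 4)⁻¹) *
        Real.exp (-(r * g.dist a b))) :=
    hasMajorant_comp_decay (R := R) (H := H) blk d δ₀ (2 * α) β r δ (Λ ^ 2) (κC * α₁) Bc (fun a => g.len a ^ 4)
      (fun a => (g.len a ^ 4)⁻¹) hw4p hw4 (by positivity) (mul_nonneg hκC hα₁) hBc hr0 hrδ hdnn htri t4 h261 hCp
      hCinvr
  have u1' : HasMajorant (g := toB6 g R H) blk (Cp * Cinv)
      (fun a b => (κC * α₁ * Bc * Λ ^ 2 * B6.c1 d δ₀ β) * Real.exp (-(r * g.dist a b))) := by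
    refine hasMajorant_mono (g := toB6 g R H) blk u1 fun a b => le_of_eq ?_
    have ha : g.len a ≠ 0 := (hlen a).ne'
    field_simp
  have u3 : HasMajorant (g := toB6 g R H) blk (Cinv' * (Cp * Cinv))
      (fun a b => (Bc' * (κC * α₁ * Bc * Λ ^ 2 * B6.c1 d δ₀ β) * B6.c1 d δ₀ β) * (g.len a ^ 4)⁻¹ *
        Real.exp (-(r * g.dist a b))) :=
    hasMajorant_comp_decay_right1 (R := R) (H := H) blk d δ₀ (2 * α) β r δ Bc' (κC * α₁ * Bc * Λ ^ 2 * B6.c1 d δ₀ β)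
      (fun a => (g.len a ^ 4)⁻¹) hw4 hBc' (by positivity) hr0 hαδ hrδ hdnn htri h261 hCinv' u1'
  have hC3 : HasMajorant (g := toB6 g R H) blk (Cinv' * Cp * Cinv)
      (fun a b => (Bc' * (κC * α₁ * Bc * Λ ^ 2 * B6.c1 d δ₀ β) * B6.c1 d δ₀ β) * (g.len a ^ 4)⁻¹ *
        Real.exp (-(r * g.dist a b))) := by
    rw [mul_assoc]; exact u3
  have hW3 := hasMajorant_word5 (R := R) (H := H) blk d δ₀ (2 * α) β ρ r (Λ ^ 2) κQ (κQ + cF * α₁)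
    BX (Bc' * (κC * α₁ * Bc * Λ ^ 2 * B6.c1 d δ₀ β) * B6.c1 d δ₀ β) BE3 wX (fun a => (g.len a ^ 4)⁻¹)
    (fun a => g.len a) hwX hw4 hw1 hκQ hκ' hBX (by positivity) hBE3 (by positivity) hρ hρr' hdnn htri h261 t1 t41
    hXr hQs hC3 hQ' hEDsρ
  -- W4 = X·Q′*·Cinv·F′₂·(E D*)
  have hW4 := hasMajorant_word5 (R := R) (H := H) blk d δ₀ (2 * α) β ρ r (Λ ^ 2) κQ (cF * α₁)
    BX Bc BE3 wX (fun a => (g.len a ^ 4)⁻¹) (fun a => g.len a) hwX hw4 hw1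
    hκQ hcFα hBX hBc hBE3 (by positivity) hρ hρr' hdnn htri h261 t1 t41 hXr hQs hCinvr hF hEDsρ
  -- W5 = X·Q′*·Cinv·Q′·(G′V′E D*), the bracket by hypothesis
  have hW5 := hasMajorant_word5 (R := R) (H := H) blk d δ₀ (2 * α) β ρ r (Λ ^ 2) κQ κQ
    BX Bc (α₁ * BE3 * Λ ^ 4 * B6.c1 d δ₀ β ^ 2 * (BG3 * cB + BG * cC)) wX (fun a => (g.len a ^ 4)⁻¹)
    (fun a => g.len a) hwX hw4 hw1 hκQ hκQ hBX hBc (by positivity) (by positivity) hρ hρr' hdnn htri h261 t1 t41 hXr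
    hQs hCinvr hQ hB5
  -- the signed sum
  have hsum := hasMajorant_add (g := toB6 g R H) blk (hasMajorant_add (g := toB6 g R H) blk
    (hasMajorant_sub (R := R) (H := H) blk (hasMajorant_add (g := toB6 g R H) blk hW1 hW2) hW3) hW4) hW5
  refine hasMajorant_mono (g := toB6 g R H) blk hsum fun a b => le_of_eq ?_
  simp only [kappa368Ds]
  ring

/-- **(3.68)₃ `P′(A)·D*` from the word-5 bracket** — gen 7's `B9Ineq368PPrimeDs.ineq368_op_Ds` with the divergence-form
letters (`hV`, `hGDv`, `hBpp`, `hCpp`, and the two transfers they need) replaced by the bracket `hB5`: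
`P′(A)·D* ≺ κ₃₆₈ᴰ(B_X = B_G)·α₁·(Lʲη)⁻¹·e^{−ρd}`.
[cite: Balaban1985BackgroundPropagators, (3.68) p.403 + (3.42) p.397 + p.398 remarks + (3.57)–(3.67) pp.401–403; Balaban1984PropagatorsII, Lemma 2.1 p.234] -/
theorem ineq368_op_Ds_of_bracket (blk : W → g.Site) (d : ℕ)
    (δ₀ δ α β ρ Λ κQ cF cV κC BG BG3 BE BE3 Bc Bc' cB cC α₁ : ℝ)
    (hκQ : 0 ≤ κQ) (hcF : 0 ≤ cF) (hcV : 0 ≤ cV) (hκC : 0 ≤ κC) (hBG : 0 ≤ BG) (hBG3 : 0 ≤ BG3) (hBE : 0 ≤ BE)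
    (hBE3 : 0 ≤ BE3) (hBc : 0 ≤ Bc) (hBc' : 0 ≤ Bc') (hcB : 0 ≤ cB) (hcC : 0 ≤ cC) (hα₁ : 0 ≤ α₁) (hΛ : 1 ≤ Λ)
    (hρ : 0 ≤ ρ) (hα : 0 ≤ α) (hβ : 0 ≤ β) (hδ₀ : 0 ≤ δ₀) (hr : ρ + 2 * ((2 * α + β) * δ₀) ≤ δ)
    (hdnn : ∀ a b : g.Site, 0 ≤ g.dist a b) (htri : Triangle254 (toB6 g R H)) (hlen : ∀ y : g.Site, 0 < g.len y)
    (h261 : Ineq261 d (toB6 g R H) δ₀ β)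
    (hT1 : ScaleTransfer g δ₀ α Λ (fun a => g.len a)) (hT4 : ScaleTransfer g δ₀ α Λ (fun a => (g.len a ^ 4)⁻¹))
    {G E V Qs Q Qs' Q' F₂ F₂s Cinv Cinv' Cp Ds : Module.End ℝ (W → ℝ)}
    (h357 : Q' = Q + F₂) (h357s : Qs' = Qs + F₂s) (h365 : E = G + G * V * E)
    (hC : Cinv' - Cinv = -(Cinv' * Cp * Cinv))
    (hG : HasMajorant (g := toB6 g R H) blk G (fun a b => BG * g.len a ^ 2 * Real.exp (-(δ * g.dist a b))))
    (hEDs : HasMajorant (g := toB6 g R H) blk (E * Ds) (fun a b => BE3 * g.len a * Real.exp (-(δ * g.dist a b))))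
    (hVE : HasMajorant (g := toB6 g R H) blk (V * E) (fun a b => cV * α₁ * BE * Real.exp (-(δ * g.dist a b))))
    (hB5 : HasMajorant (g := toB6 g R H) blk (G * V * E * Ds)
      (fun a b => (α₁ * BE3 * Λ ^ 4 * B6.c1 d δ₀ β ^ 2 * (BG3 * cB + BG * cC)) * g.len a *
        Real.exp (-(ρ * g.dist a b))))
    (hQ : HasMajorant (g := toB6 g R H) blk Q (fun a b : g.Site => if a = b then κQ else 0))
    (hQs : HasMajorant (g := toB6 g R H) blk Qs (fun a b : g.Site => if a = b then κQ else 0))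
    (hF : HasMajorant (g := toB6 g R H) blk F₂ (fun a b : g.Site => if a = b then cF * α₁ else 0))
    (hFs : HasMajorant (g := toB6 g R H) blk F₂s (fun a b : g.Site => if a = b then cF * α₁ else 0))
    (hCinv : HasMajorant (g := toB6 g R H) blk Cinv
      (fun a b => Bc * (g.len a ^ 4)⁻¹ * Real.exp (-(δ * g.dist a b))))
    (hCinv' : HasMajorant (g := toB6 g R H) blk Cinv'
      (fun a b => Bc' * (g.len a ^ 4)⁻¹ * Real.exp (-(δ * g.dist a b))))
    (hCp : HasMajorant (g := toB6 g R H) blk Cp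
      (fun a b => κC * α₁ * g.len a ^ 4 * Real.exp (-(δ * g.dist a b)))) :
    HasMajorant (g := toB6 g R H) blk (B9Eq360Vprime.pPrime G E Qs Qs' Cinv Cinv' Q Q' * Ds)
      (fun a b => kappa368Ds κQ cF cV κC BG BG3 BG BE BE3 Bc Bc' cB cC Λ (B6.c1 d δ₀ β) α₁ * α₁ * (g.len a)⁻¹ *
        Real.exp (-(ρ * g.dist a b))) := by
  have hw2 : ∀ a : g.Site, 0 ≤ g.len a ^ 2 := fun a => sq_nonneg _
  rw [B9Eq360Vprime.pPrime_explicit G E Qs Qs' Cinv Cinv' Q Q' V F₂ F₂s Cp h365 h357 h357s hC]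
  have e : (G * V * E * Qs' * Cinv' * Q' * E + G * F₂s * Cinv' * Q' * E - G * Qs * (Cinv' * Cp * Cinv) * Q' * E
        + G * Qs * Cinv * F₂ * E + G * Qs * Cinv * Q * (G * V * E)) * Ds
      = G * V * E * Qs' * Cinv' * Q' * (E * Ds) + G * F₂s * Cinv' * Q' * (E * Ds)
        - G * Qs * (Cinv' * Cp * Cinv) * Q' * (E * Ds) + G * Qs * Cinv * F₂ * (E * Ds)
        + G * Qs * Cinv * Q * (G * V * E * Ds) := by
    simp only [add_mul, sub_mul, mul_assoc]
  rw [e]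
  have h := hasMajorant_pPrime_words_Ds_of_bracket (R := R) (H := H) blk d δ₀ δ α β ρ Λ κQ cF cV κC BG BG3 BG BE BE3
    Bc Bc' cB cC α₁ (fun a => g.len a ^ 2) hw2 hκQ hcF hcV hκC hBG hBG3 hBG hBE hBE3 hBc hBc' hcB hcC hα₁ hΛ hρ hα hβ
    hδ₀ hr hdnn htri hlen h261 hT1 hT4 h357 h357s hG hEDs hVE hB5 hQ hQs hF hFs hCinv hCinv' hCp
  refine hasMajorant_mono (g := toB6 g R H) blk h fun a b => le_of_eq ?_
  have ha : g.len a ≠ 0 := (hlen a).ne'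
  field_simp

/-- **(3.68)₄ `D·P′(A)·D*` from the word-5 bracket** — gen 7's `B9Ineq368PPrimeDs.ineq368_op_DDs` with the divergence-form
letters replaced by `hB5` (left end letter `∇G′(U)`, `hDG`): `D·P′(A)·D* ≺ κ₃₆₈ᴰ(B_X = B_D)·α₁·(Lʲη)⁻²·e^{−ρd}`.
[cite: Balaban1985BackgroundPropagators, (3.68) p.403 + (3.42) p.397 + p.398 remarks; Balaban1984PropagatorsII, Lemma 2.1 p.234] -/
theorem ineq368_op_DDs_of_bracket (blk : W → g.Site) (d : ℕ)
    (δ₀ δ α β ρ Λ κQ cF cV κC BG BG3 BD BE BE3 Bc Bc' cB cC α₁ : ℝ)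
    (hκQ : 0 ≤ κQ) (hcF : 0 ≤ cF) (hcV : 0 ≤ cV) (hκC : 0 ≤ κC) (hBG : 0 ≤ BG) (hBG3 : 0 ≤ BG3) (hBD : 0 ≤ BD)
    (hBE : 0 ≤ BE) (hBE3 : 0 ≤ BE3) (hBc : 0 ≤ Bc) (hBc' : 0 ≤ Bc') (hcB : 0 ≤ cB) (hcC : 0 ≤ cC) (hα₁ : 0 ≤ α₁)
    (hΛ : 1 ≤ Λ) (hρ : 0 ≤ ρ) (hα : 0 ≤ α) (hβ : 0 ≤ β) (hδ₀ : 0 ≤ δ₀) (hr : ρ + 2 * ((2 * α + β) * δ₀) ≤ δ)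
    (hdnn : ∀ a b : g.Site, 0 ≤ g.dist a b) (htri : Triangle254 (toB6 g R H)) (hlen : ∀ y : g.Site, 0 < g.len y)
    (h261 : Ineq261 d (toB6 g R H) δ₀ β)
    (hT1 : ScaleTransfer g δ₀ α Λ (fun a => g.len a)) (hT4 : ScaleTransfer g δ₀ α Λ (fun a => (g.len a ^ 4)⁻¹))
    {G D E V Qs Q Qs' Q' F₂ F₂s Cinv Cinv' Cp Ds : Module.End ℝ (W → ℝ)}
    (h357 : Q' = Q + F₂) (h357s : Qs' = Qs + F₂s) (h365 : E = G + G * V * E)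
    (hC : Cinv' - Cinv = -(Cinv' * Cp * Cinv))
    (hDG : HasMajorant (g := toB6 g R H) blk (D * G) (fun a b => BD * g.len a * Real.exp (-(δ * g.dist a b))))
    (hEDs : HasMajorant (g := toB6 g R H) blk (E * Ds) (fun a b => BE3 * g.len a * Real.exp (-(δ * g.dist a b))))
    (hVE : HasMajorant (g := toB6 g R H) blk (V * E) (fun a b => cV * α₁ * BE * Real.exp (-(δ * g.dist a b))))
    (hB5 : HasMajorant (g := toB6 g R H) blk (G * V * E * Ds)
      (fun a b => (α₁ * BE3 * Λ ^ 4 * B6.c1 d δ₀ β ^ 2 * (BG3 * cB + BG * cC)) * g.len a *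
        Real.exp (-(ρ * g.dist a b))))
    (hQ : HasMajorant (g := toB6 g R H) blk Q (fun a b : g.Site => if a = b then κQ else 0))
    (hQs : HasMajorant (g := toB6 g R H) blk Qs (fun a b : g.Site => if a = b then κQ else 0))
    (hF : HasMajorant (g := toB6 g R H) blk F₂ (fun a b : g.Site => if a = b then cF * α₁ else 0))
    (hFs : HasMajorant (g := toB6 g R H) blk F₂s (fun a b : g.Site => if a = b then cF * α₁ else 0))
    (hCinv : HasMajorant (g := toB6 g R H) blk Cinv
      (fun a b => Bc * (g.len a ^ 4)⁻¹ * Real.exp (-(δ * g.dist a b))))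
    (hCinv' : HasMajorant (g := toB6 g R H) blk Cinv'
      (fun a b => Bc' * (g.len a ^ 4)⁻¹ * Real.exp (-(δ * g.dist a b))))
    (hCp : HasMajorant (g := toB6 g R H) blk Cp
      (fun a b => κC * α₁ * g.len a ^ 4 * Real.exp (-(δ * g.dist a b)))) :
    HasMajorant (g := toB6 g R H) blk (D * B9Eq360Vprime.pPrime G E Qs Qs' Cinv Cinv' Q Q' * Ds)
      (fun a b => kappa368Ds κQ cF cV κC BG BG3 BD BE BE3 Bc Bc' cB cC Λ (B6.c1 d δ₀ β) α₁ * α₁ * (g.len a ^ 2)⁻¹ *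
        Real.exp (-(ρ * g.dist a b))) := by
  have hw1 : ∀ a : g.Site, 0 ≤ g.len a := fun a => (hlen a).le
  rw [B9Eq360Vprime.pPrime_explicit G E Qs Qs' Cinv Cinv' Q Q' V F₂ F₂s Cp h365 h357 h357s hC]
  have e : D * (G * V * E * Qs' * Cinv' * Q' * E + G * F₂s * Cinv' * Q' * E - G * Qs * (Cinv' * Cp * Cinv) * Q' * E
        + G * Qs * Cinv * F₂ * E + G * Qs * Cinv * Q * (G * V * E)) * Ds
      = D * G * V * E * Qs' * Cinv' * Q' * (E * Ds) + D * G * F₂s * Cinv' * Q' * (E * Ds)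
        - D * G * Qs * (Cinv' * Cp * Cinv) * Q' * (E * Ds) + D * G * Qs * Cinv * F₂ * (E * Ds)
        + D * G * Qs * Cinv * Q * (G * V * E * Ds) := by
    simp only [add_mul, sub_mul, mul_add, mul_sub, mul_assoc]
  rw [e]
  have h := hasMajorant_pPrime_words_Ds_of_bracket (R := R) (H := H) blk d δ₀ δ α β ρ Λ κQ cF cV κC BG BG3 BD BE BE3
    Bc Bc' cB cC α₁ (fun a => g.len a) hw1 hκQ hcF hcV hκC hBG hBG3 hBD hBE hBE3 hBc hBc' hcB hcC hα₁ hΛ hρ hα hβ hδ₀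
    hr hdnn htri hlen h261 hT1 hT4 h357 h357s hDG hEDs hVE hB5 hQ hQs hF hFs hCinv hCinv' hCp
  refine hasMajorant_mono (g := toB6 g R H) blk h fun a b => le_of_eq ?_
  have ha : g.len a ≠ 0 := (hlen a).ne'
  field_simp

/-! ## §3  (3.68)₃,₄ for the finite-sum divergence form, and for the finite-sum gradient form with commutator letters -/

/-- **(3.68)₃ `P′(A)·D*` for the finite-sum divergence form `V′ = Σ_{k∈s} ∇♯_kB″_k + C″`** (one letter per bond of
`st(x)`; `Σ_k c_{B,k} ≦ c_B`): the statement of `B9Ineq368PPrimeDs.ineq368_op_Ds` with `Σ_k` (constant `κ₃₆₈ᴰ` unchanged).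
[cite: Balaban1985BackgroundPropagators, (3.68) p.403 + (3.60)–(3.61) p.402 + (3.52) p.400 + (3.42) p.397 + p.398 remarks; Balaban1984PropagatorsII, Lemma 2.1 p.234 + (2.52)–(2.55) p.232] -/
theorem ineq368_op_Ds_sum (blk : W → g.Site) (d : ℕ) (s : Finset K)
    (δ₀ δ α β ρ Λ κQ cF cV κC BG BG3 BE BE3 Bc Bc' cB cC α₁ : ℝ) (cBk : K → ℝ)
    (hκQ : 0 ≤ κQ) (hcF : 0 ≤ cF) (hcV : 0 ≤ cV) (hκC : 0 ≤ κC) (hBG : 0 ≤ BG) (hBG3 : 0 ≤ BG3) (hBE : 0 ≤ BE)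
    (hBE3 : 0 ≤ BE3) (hBc : 0 ≤ Bc) (hBc' : 0 ≤ Bc') (hcB : 0 ≤ cB) (hcC : 0 ≤ cC) (hα₁ : 0 ≤ α₁) (hΛ : 1 ≤ Λ)
    (hρ : 0 ≤ ρ) (hα : 0 ≤ α) (hβ : 0 ≤ β) (hδ₀ : 0 ≤ δ₀) (hr : ρ + 2 * ((2 * α + β) * δ₀) ≤ δ)
    (hcBk : ∀ k ∈ s, 0 ≤ cBk k) (hsum : ∑ k ∈ s, cBk k ≤ cB)
    (hdnn : ∀ a b : g.Site, 0 ≤ g.dist a b) (htri : Triangle254 (toB6 g R H)) (hlen : ∀ y : g.Site, 0 < g.len y)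
    (h261 : Ineq261 d (toB6 g R H) δ₀ β)
    (hT1 : ScaleTransfer g δ₀ α Λ (fun a => g.len a)) (hT1i : ScaleTransfer g δ₀ α Λ (fun a => (g.len a)⁻¹))
    (hT2i : ScaleTransfer g δ₀ α Λ (fun a => (g.len a ^ 2)⁻¹)) (hT4 : ScaleTransfer g δ₀ α Λ (fun a => (g.len a ^ 4)⁻¹))
    {G E V Qs Q Qs' Q' F₂ F₂s Cinv Cinv' Cp Ds Cpp : Module.End ℝ (W → ℝ)} {Dv Bpp : K → Module.End ℝ (W → ℝ)}
    (h357 : Q' = Q + F₂) (h357s : Qs' = Qs + F₂s) (h365 : E = G + G * V * E)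
    (hC : Cinv' - Cinv = -(Cinv' * Cp * Cinv)) (hV : V = ∑ k ∈ s, Dv k * Bpp k + Cpp)
    (hG : HasMajorant (g := toB6 g R H) blk G (fun a b => BG * g.len a ^ 2 * Real.exp (-(δ * g.dist a b))))
    (hGDv : ∀ k ∈ s, HasMajorant (g := toB6 g R H) blk (G * Dv k)
      (fun a b => BG3 * g.len a * Real.exp (-(δ * g.dist a b))))
    (hEDs : HasMajorant (g := toB6 g R H) blk (E * Ds) (fun a b => BE3 * g.len a * Real.exp (-(δ * g.dist a b))))
    (hVE : HasMajorant (g := toB6 g R H) blk (V * E) (fun a b => cV * α₁ * BE * Real.exp (-(δ * g.dist a b))))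
    (hBpp : ∀ k ∈ s, HasMajorant (g := toB6 g R H) blk (Bpp k)
      (fun a b => cBk k * α₁ * (g.len a)⁻¹ * Real.exp (-(δ * g.dist a b))))
    (hCpp : HasMajorant (g := toB6 g R H) blk Cpp
      (fun a b => cC * α₁ * (g.len a ^ 2)⁻¹ * Real.exp (-(δ * g.dist a b))))
    (hQ : HasMajorant (g := toB6 g R H) blk Q (fun a b : g.Site => if a = b then κQ else 0))
    (hQs : HasMajorant (g := toB6 g R H) blk Qs (fun a b : g.Site => if a = b then κQ else 0))
    (hF : HasMajorant (g := toB6 g R H) blk F₂ (fun a b : g.Site => if a = b then cF * α₁ else 0))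
    (hFs : HasMajorant (g := toB6 g R H) blk F₂s (fun a b : g.Site => if a = b then cF * α₁ else 0))
    (hCinv : HasMajorant (g := toB6 g R H) blk Cinv
      (fun a b => Bc * (g.len a ^ 4)⁻¹ * Real.exp (-(δ * g.dist a b))))
    (hCinv' : HasMajorant (g := toB6 g R H) blk Cinv'
      (fun a b => Bc' * (g.len a ^ 4)⁻¹ * Real.exp (-(δ * g.dist a b))))
    (hCp : HasMajorant (g := toB6 g R H) blk Cp
      (fun a b => κC * α₁ * g.len a ^ 4 * Real.exp (-(δ * g.dist a b)))) :
    HasMajorant (g := toB6 g R H) blk (B9Eq360Vprime.pPrime G E Qs Qs' Cinv Cinv' Q Q' * Ds)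
      (fun a b => kappa368Ds κQ cF cV κC BG BG3 BG BE BE3 Bc Bc' cB cC Λ (B6.c1 d δ₀ β) α₁ * α₁ * (g.len a)⁻¹ *
        Real.exp (-(ρ * g.dist a b))) := by
  have hB5 := hasMajorant_GVEDs_sum (R := R) (H := H) blk d s δ₀ δ α β ρ Λ BG BG3 BE3 cB cC α₁ cBk hBG hBG3 hBE3
    hcC hα₁ hΛ hρ hα hβ hδ₀ hr hcBk hsum hdnn htri hlen h261 hT1 hT1i hT2i hV hG hGDv hEDs hBpp hCpp
  exact ineq368_op_Ds_of_bracket (R := R) (H := H) blk d δ₀ δ α β ρ Λ κQ cF cV κC BG BG3 BE BE3 Bc Bc' cB cC α₁ hκQ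
    hcF hcV hκC hBG hBG3 hBE hBE3 hBc hBc' hcB hcC hα₁ hΛ hρ hα hβ hδ₀ hr hdnn htri hlen h261 hT1 hT4 h357 h357s h365
    hC hG hEDs hVE hB5 hQ hQs hF hFs hCinv hCinv' hCp

/-- **(3.68)₄ `D·P′(A)·D*` for the finite-sum divergence form** (left end letter `∇G′(U)`).
[cite: Balaban1985BackgroundPropagators, (3.68) p.403 + (3.60)–(3.61) p.402 + (3.52) p.400 + (3.42) p.397 + p.398 remarks; Balaban1984PropagatorsII, Lemma 2.1 p.234 + (2.52)–(2.55) p.232] -/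
theorem ineq368_op_DDs_sum (blk : W → g.Site) (d : ℕ) (s : Finset K)
    (δ₀ δ α β ρ Λ κQ cF cV κC BG BG3 BD BE BE3 Bc Bc' cB cC α₁ : ℝ) (cBk : K → ℝ)
    (hκQ : 0 ≤ κQ) (hcF : 0 ≤ cF) (hcV : 0 ≤ cV) (hκC : 0 ≤ κC) (hBG : 0 ≤ BG) (hBG3 : 0 ≤ BG3) (hBD : 0 ≤ BD)
    (hBE : 0 ≤ BE) (hBE3 : 0 ≤ BE3) (hBc : 0 ≤ Bc) (hBc' : 0 ≤ Bc') (hcB : 0 ≤ cB) (hcC : 0 ≤ cC) (hα₁ : 0 ≤ α₁)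
    (hΛ : 1 ≤ Λ) (hρ : 0 ≤ ρ) (hα : 0 ≤ α) (hβ : 0 ≤ β) (hδ₀ : 0 ≤ δ₀) (hr : ρ + 2 * ((2 * α + β) * δ₀) ≤ δ)
    (hcBk : ∀ k ∈ s, 0 ≤ cBk k) (hsum : ∑ k ∈ s, cBk k ≤ cB)
    (hdnn : ∀ a b : g.Site, 0 ≤ g.dist a b) (htri : Triangle254 (toB6 g R H)) (hlen : ∀ y : g.Site, 0 < g.len y)
    (h261 : Ineq261 d (toB6 g R H) δ₀ β)
    (hT1 : ScaleTransfer g δ₀ α Λ (fun a => g.len a)) (hT1i : ScaleTransfer g δ₀ α Λ (fun a => (g.len a)⁻¹))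
    (hT2i : ScaleTransfer g δ₀ α Λ (fun a => (g.len a ^ 2)⁻¹)) (hT4 : ScaleTransfer g δ₀ α Λ (fun a => (g.len a ^ 4)⁻¹))
    {G D E V Qs Q Qs' Q' F₂ F₂s Cinv Cinv' Cp Ds Cpp : Module.End ℝ (W → ℝ)} {Dv Bpp : K → Module.End ℝ (W → ℝ)}
    (h357 : Q' = Q + F₂) (h357s : Qs' = Qs + F₂s) (h365 : E = G + G * V * E)
    (hC : Cinv' - Cinv = -(Cinv' * Cp * Cinv)) (hV : V = ∑ k ∈ s, Dv k * Bpp k + Cpp)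
    (hG : HasMajorant (g := toB6 g R H) blk G (fun a b => BG * g.len a ^ 2 * Real.exp (-(δ * g.dist a b))))
    (hDG : HasMajorant (g := toB6 g R H) blk (D * G) (fun a b => BD * g.len a * Real.exp (-(δ * g.dist a b))))
    (hGDv : ∀ k ∈ s, HasMajorant (g := toB6 g R H) blk (G * Dv k)
      (fun a b => BG3 * g.len a * Real.exp (-(δ * g.dist a b))))
    (hEDs : HasMajorant (g := toB6 g R H) blk (E * Ds) (fun a b => BE3 * g.len a * Real.exp (-(δ * g.dist a b))))
    (hVE : HasMajorant (g := toB6 g R H) blk (V * E) (fun a b => cV * α₁ * BE * Real.exp (-(δ * g.dist a b))))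
    (hBpp : ∀ k ∈ s, HasMajorant (g := toB6 g R H) blk (Bpp k)
      (fun a b => cBk k * α₁ * (g.len a)⁻¹ * Real.exp (-(δ * g.dist a b))))
    (hCpp : HasMajorant (g := toB6 g R H) blk Cpp
      (fun a b => cC * α₁ * (g.len a ^ 2)⁻¹ * Real.exp (-(δ * g.dist a b))))
    (hQ : HasMajorant (g := toB6 g R H) blk Q (fun a b : g.Site => if a = b then κQ else 0))
    (hQs : HasMajorant (g := toB6 g R H) blk Qs (fun a b : g.Site => if a = b then κQ else 0))
    (hF : HasMajorant (g := toB6 g R H) blk F₂ (fun a b : g.Site => if a = b then cF * α₁ else 0))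
    (hFs : HasMajorant (g := toB6 g R H) blk F₂s (fun a b : g.Site => if a = b then cF * α₁ else 0))
    (hCinv : HasMajorant (g := toB6 g R H) blk Cinv
      (fun a b => Bc * (g.len a ^ 4)⁻¹ * Real.exp (-(δ * g.dist a b))))
    (hCinv' : HasMajorant (g := toB6 g R H) blk Cinv'
      (fun a b => Bc' * (g.len a ^ 4)⁻¹ * Real.exp (-(δ * g.dist a b))))
    (hCp : HasMajorant (g := toB6 g R H) blk Cp
      (fun a b => κC * α₁ * g.len a ^ 4 * Real.exp (-(δ * g.dist a b)))) :
    HasMajorant (g := toB6 g R H) blk (D * B9Eq360Vprime.pPrime G E Qs Qs' Cinv Cinv' Q Q' * Ds)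
      (fun a b => kappa368Ds κQ cF cV κC BG BG3 BD BE BE3 Bc Bc' cB cC Λ (B6.c1 d δ₀ β) α₁ * α₁ * (g.len a ^ 2)⁻¹ *
        Real.exp (-(ρ * g.dist a b))) := by
  have hB5 := hasMajorant_GVEDs_sum (R := R) (H := H) blk d s δ₀ δ α β ρ Λ BG BG3 BE3 cB cC α₁ cBk hBG hBG3 hBE3
    hcC hα₁ hΛ hρ hα hβ hδ₀ hr hcBk hsum hdnn htri hlen h261 hT1 hT1i hT2i hV hG hGDv hEDs hBpp hCpp
  exact ineq368_op_DDs_of_bracket (R := R) (H := H) blk d δ₀ δ α β ρ Λ κQ cF cV κC BG BG3 BD BE BE3 Bc Bc' cB cC α₁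
    hκQ hcF hcV hκC hBG hBG3 hBD hBE hBE3 hBc hBc' hcB hcC hα₁ hΛ hρ hα hβ hδ₀ hr hdnn htri hlen h261 hT1 hT4 h357 h357s
    h365 hC hDG hEDs hVE hB5 hQ hQs hF hFs hCinv hCinv' hCp

/-- **(3.68)₃ `P′(A)·D*` from the finite-sum GRADIENT form of `V′` and one commutator letter per difference letter**: the
hypotheses of `B9Ineq368PPrimeDs.ineq368_op_Ds_of_comm` with `V′ = V⁰ + Σ_{k∈s} V¹_k∇_k` (`V¹_k ≺ c_{B,k}α₁(Lʲη)⁻¹e^{−δd}`,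
`Σ_k c_{B,k} ≦ c_B`, `V⁰ ≺ c_Cα₁(Lʲη)⁻²e^{−δd}` — the (3.61)/(3.54) sizes), the commutator letters `V¹_k∇_k − ∇_kV¹_k ≺
c_{M,k}α₁(Lʲη)⁻²e^{−δd}` (`c_{M,k} ≧ 0`; the (3.37) sizes — for the concrete letters of (3.52)
`B9Eq352DivFormLetters.hasMajorant_comm_forward/backward`) and the entries `G′(U)∇_k ≺ B_{G3}Lʲη e^{−δd}` (Theorem 3.1,
p. 398 remark): `P′(A)·D* ≺ κ₃₆₈ᴰ(c_C + Σ_kc_{M,k} for c_C)·α₁·(Lʲη)⁻¹·e^{−ρd}`.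
[cite: Balaban1985BackgroundPropagators, (3.68) p.403 + (3.60)–(3.61) p.402 + (3.52)–(3.54) pp.400–401 + (3.37) p.396 + (3.42) p.397 + p.398 remarks; Balaban1985RegularSpaces, (1.87) p.91; Balaban1984PropagatorsII, Lemma 2.1 p.234] -/
theorem ineq368_op_Ds_of_comm_sum (blk : W → g.Site) (d : ℕ) (s : Finset K)
    (δ₀ δ α β ρ Λ κQ cF cV κC BG BG3 BE BE3 Bc Bc' cB cC α₁ : ℝ) (cBk cMk : K → ℝ)
    (hκQ : 0 ≤ κQ) (hcF : 0 ≤ cF) (hcV : 0 ≤ cV) (hκC : 0 ≤ κC) (hBG : 0 ≤ BG) (hBG3 : 0 ≤ BG3) (hBE : 0 ≤ BE)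
    (hBE3 : 0 ≤ BE3) (hBc : 0 ≤ Bc) (hBc' : 0 ≤ Bc') (hcB : 0 ≤ cB) (hcC : 0 ≤ cC) (hα₁ : 0 ≤ α₁)
    (hΛ : 1 ≤ Λ) (hρ : 0 ≤ ρ) (hα : 0 ≤ α) (hβ : 0 ≤ β) (hδ₀ : 0 ≤ δ₀) (hr : ρ + 2 * ((2 * α + β) * δ₀) ≤ δ)
    (hcBk : ∀ k ∈ s, 0 ≤ cBk k) (hsum : ∑ k ∈ s, cBk k ≤ cB) (hcMk : ∀ k ∈ s, 0 ≤ cMk k)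
    (hdnn : ∀ a b : g.Site, 0 ≤ g.dist a b) (htri : Triangle254 (toB6 g R H)) (hlen : ∀ y : g.Site, 0 < g.len y)
    (h261 : Ineq261 d (toB6 g R H) δ₀ β)
    (hT1 : ScaleTransfer g δ₀ α Λ (fun a => g.len a)) (hT1i : ScaleTransfer g δ₀ α Λ (fun a => (g.len a)⁻¹))
    (hT2i : ScaleTransfer g δ₀ α Λ (fun a => (g.len a ^ 2)⁻¹)) (hT4 : ScaleTransfer g δ₀ α Λ (fun a => (g.len a ^ 4)⁻¹))
    {G E V Qs Q Qs' Q' F₂ F₂s Cinv Cinv' Cp Ds V0 : Module.End ℝ (W → ℝ)} {V1 D : K → Module.End ℝ (W → ℝ)}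
    (h357 : Q' = Q + F₂) (h357s : Qs' = Qs + F₂s) (h365 : E = G + G * V * E)
    (hC : Cinv' - Cinv = -(Cinv' * Cp * Cinv)) (hVg : V = V0 + ∑ k ∈ s, V1 k * D k)
    (hG : HasMajorant (g := toB6 g R H) blk G (fun a b => BG * g.len a ^ 2 * Real.exp (-(δ * g.dist a b))))
    (hGD : ∀ k ∈ s, HasMajorant (g := toB6 g R H) blk (G * D k)
      (fun a b => BG3 * g.len a * Real.exp (-(δ * g.dist a b))))
    (hEDs : HasMajorant (g := toB6 g R H) blk (E * Ds) (fun a b => BE3 * g.len a * Real.exp (-(δ * g.dist a b))))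
    (hVE : HasMajorant (g := toB6 g R H) blk (V * E) (fun a b => cV * α₁ * BE * Real.exp (-(δ * g.dist a b))))
    (hV0 : HasMajorant (g := toB6 g R H) blk V0 (fun a b => cC * α₁ * (g.len a ^ 2)⁻¹ * Real.exp (-(δ * g.dist a b))))
    (hV1 : ∀ k ∈ s, HasMajorant (g := toB6 g R H) blk (V1 k)
      (fun a b => cBk k * α₁ * (g.len a)⁻¹ * Real.exp (-(δ * g.dist a b))))
    (hComm : ∀ k ∈ s, HasMajorant (g := toB6 g R H) blk (V1 k * D k - D k * V1 k)
      (fun a b => cMk k * α₁ * (g.len a ^ 2)⁻¹ * Real.exp (-(δ * g.dist a b))))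
    (hQ : HasMajorant (g := toB6 g R H) blk Q (fun a b : g.Site => if a = b then κQ else 0))
    (hQs : HasMajorant (g := toB6 g R H) blk Qs (fun a b : g.Site => if a = b then κQ else 0))
    (hF : HasMajorant (g := toB6 g R H) blk F₂ (fun a b : g.Site => if a = b then cF * α₁ else 0))
    (hFs : HasMajorant (g := toB6 g R H) blk F₂s (fun a b : g.Site => if a = b then cF * α₁ else 0))
    (hCinv : HasMajorant (g := toB6 g R H) blk Cinv
      (fun a b => Bc * (g.len a ^ 4)⁻¹ * Real.exp (-(δ * g.dist a b))))
    (hCinv' : HasMajorant (g := toB6 g R H) blk Cinv'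
      (fun a b => Bc' * (g.len a ^ 4)⁻¹ * Real.exp (-(δ * g.dist a b))))
    (hCp : HasMajorant (g := toB6 g R H) blk Cp
      (fun a b => κC * α₁ * g.len a ^ 4 * Real.exp (-(δ * g.dist a b)))) :
    HasMajorant (g := toB6 g R H) blk (B9Eq360Vprime.pPrime G E Qs Qs' Cinv Cinv' Q Q' * Ds)
      (fun a b => kappa368Ds κQ cF cV κC BG BG3 BG BE BE3 Bc Bc' cB (cC + ∑ k ∈ s, cMk k) Λ (B6.c1 d δ₀ β) α₁ * α₁ *
        (g.len a)⁻¹ * Real.exp (-(ρ * g.dist a b))) := by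
  have hSM : 0 ≤ ∑ k ∈ s, cMk k := Finset.sum_nonneg hcMk
  -- divergence form and its zeroth-order letter C″ := V⁰ + Σ_k [V¹_k, ∇_k]
  have hV := divForm_of_gradForm_sum s hVg
  have hCpp := hasMajorant_C₃_of_comm_sum (R := R) (H := H) blk s δ cC α₁ cMk hV0 hComm
  exact ineq368_op_Ds_sum (R := R) (H := H) blk d s δ₀ δ α β ρ Λ κQ cF cV κC BG BG3 BE BE3 Bc Bc' cB
    (cC + ∑ k ∈ s, cMk k) α₁ cBk hκQ hcF hcV hκC hBG hBG3 hBE hBE3 hBc hBc' hcB (add_nonneg hcC hSM) hα₁ hΛ hρ hα hβ hδ₀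
    hr hcBk hsum hdnn htri hlen h261 hT1 hT1i hT2i hT4 h357 h357s h365 hC hV hG hGD hEDs hVE hV1 hCpp hQ hQs hF hFs hCinv
    hCinv' hCp

/-- **(3.68)₄ `D·P′(A)·D*` from the finite-sum GRADIENT form and the commutator letters** (left end letter `∇G′(U)`):
`D·P′(A)·D* ≺ κ₃₆₈ᴰ(B_X = B_D; c_C + Σ_kc_{M,k} for c_C)·α₁·(Lʲη)⁻²·e^{−ρd}`.
[cite: Balaban1985BackgroundPropagators, (3.68) p.403 + (3.60)–(3.61) p.402 + (3.52)–(3.54) pp.400–401 + (3.37) p.396 + (3.42) p.397 + p.398 remarks; Balaban1985RegularSpaces, (1.87) p.91; Balaban1984PropagatorsII, Lemma 2.1 p.234] -/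
theorem ineq368_op_DDs_of_comm_sum (blk : W → g.Site) (d : ℕ) (s : Finset K)
    (δ₀ δ α β ρ Λ κQ cF cV κC BG BG3 BD BE BE3 Bc Bc' cB cC α₁ : ℝ) (cBk cMk : K → ℝ)
    (hκQ : 0 ≤ κQ) (hcF : 0 ≤ cF) (hcV : 0 ≤ cV) (hκC : 0 ≤ κC) (hBG : 0 ≤ BG) (hBG3 : 0 ≤ BG3) (hBD : 0 ≤ BD)
    (hBE : 0 ≤ BE) (hBE3 : 0 ≤ BE3) (hBc : 0 ≤ Bc) (hBc' : 0 ≤ Bc') (hcB : 0 ≤ cB) (hcC : 0 ≤ cC) (hα₁ : 0 ≤ α₁)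
    (hΛ : 1 ≤ Λ) (hρ : 0 ≤ ρ) (hα : 0 ≤ α) (hβ : 0 ≤ β) (hδ₀ : 0 ≤ δ₀) (hr : ρ + 2 * ((2 * α + β) * δ₀) ≤ δ)
    (hcBk : ∀ k ∈ s, 0 ≤ cBk k) (hsum : ∑ k ∈ s, cBk k ≤ cB) (hcMk : ∀ k ∈ s, 0 ≤ cMk k)
    (hdnn : ∀ a b : g.Site, 0 ≤ g.dist a b) (htri : Triangle254 (toB6 g R H)) (hlen : ∀ y : g.Site, 0 < g.len y)
    (h261 : Ineq261 d (toB6 g R H) δ₀ β)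
    (hT1 : ScaleTransfer g δ₀ α Λ (fun a => g.len a)) (hT1i : ScaleTransfer g δ₀ α Λ (fun a => (g.len a)⁻¹))
    (hT2i : ScaleTransfer g δ₀ α Λ (fun a => (g.len a ^ 2)⁻¹)) (hT4 : ScaleTransfer g δ₀ α Λ (fun a => (g.len a ^ 4)⁻¹))
    {G D₀ E V Qs Q Qs' Q' F₂ F₂s Cinv Cinv' Cp Ds V0 : Module.End ℝ (W → ℝ)} {V1 D : K → Module.End ℝ (W → ℝ)}
    (h357 : Q' = Q + F₂) (h357s : Qs' = Qs + F₂s) (h365 : E = G + G * V * E)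
    (hC : Cinv' - Cinv = -(Cinv' * Cp * Cinv)) (hVg : V = V0 + ∑ k ∈ s, V1 k * D k)
    (hG : HasMajorant (g := toB6 g R H) blk G (fun a b => BG * g.len a ^ 2 * Real.exp (-(δ * g.dist a b))))
    (hDG : HasMajorant (g := toB6 g R H) blk (D₀ * G) (fun a b => BD * g.len a * Real.exp (-(δ * g.dist a b))))
    (hGD : ∀ k ∈ s, HasMajorant (g := toB6 g R H) blk (G * D k)
      (fun a b => BG3 * g.len a * Real.exp (-(δ * g.dist a b))))
    (hEDs : HasMajorant (g := toB6 g R H) blk (E * Ds) (fun a b => BE3 * g.len a * Real.exp (-(δ * g.dist a b))))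
    (hVE : HasMajorant (g := toB6 g R H) blk (V * E) (fun a b => cV * α₁ * BE * Real.exp (-(δ * g.dist a b))))
    (hV0 : HasMajorant (g := toB6 g R H) blk V0 (fun a b => cC * α₁ * (g.len a ^ 2)⁻¹ * Real.exp (-(δ * g.dist a b))))
    (hV1 : ∀ k ∈ s, HasMajorant (g := toB6 g R H) blk (V1 k)
      (fun a b => cBk k * α₁ * (g.len a)⁻¹ * Real.exp (-(δ * g.dist a b))))
    (hComm : ∀ k ∈ s, HasMajorant (g := toB6 g R H) blk (V1 k * D k - D k * V1 k)
      (fun a b => cMk k * α₁ * (g.len a ^ 2)⁻¹ * Real.exp (-(δ * g.dist a b))))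
    (hQ : HasMajorant (g := toB6 g R H) blk Q (fun a b : g.Site => if a = b then κQ else 0))
    (hQs : HasMajorant (g := toB6 g R H) blk Qs (fun a b : g.Site => if a = b then κQ else 0))
    (hF : HasMajorant (g := toB6 g R H) blk F₂ (fun a b : g.Site => if a = b then cF * α₁ else 0))
    (hFs : HasMajorant (g := toB6 g R H) blk F₂s (fun a b : g.Site => if a = b then cF * α₁ else 0))
    (hCinv : HasMajorant (g := toB6 g R H) blk Cinv
      (fun a b => Bc * (g.len a ^ 4)⁻¹ * Real.exp (-(δ * g.dist a b))))
    (hCinv' : HasMajorant (g := toB6 g R H) blk Cinv'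
      (fun a b => Bc' * (g.len a ^ 4)⁻¹ * Real.exp (-(δ * g.dist a b))))
    (hCp : HasMajorant (g := toB6 g R H) blk Cp
      (fun a b => κC * α₁ * g.len a ^ 4 * Real.exp (-(δ * g.dist a b)))) :
    HasMajorant (g := toB6 g R H) blk (D₀ * B9Eq360Vprime.pPrime G E Qs Qs' Cinv Cinv' Q Q' * Ds)
      (fun a b => kappa368Ds κQ cF cV κC BG BG3 BD BE BE3 Bc Bc' cB (cC + ∑ k ∈ s, cMk k) Λ (B6.c1 d δ₀ β) α₁ * α₁ *
        (g.len a ^ 2)⁻¹ * Real.exp (-(ρ * g.dist a b))) := by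
  have hSM : 0 ≤ ∑ k ∈ s, cMk k := Finset.sum_nonneg hcMk
  have hV := divForm_of_gradForm_sum s hVg
  have hCpp := hasMajorant_C₃_of_comm_sum (R := R) (H := H) blk s δ cC α₁ cMk hV0 hComm
  exact ineq368_op_DDs_sum (R := R) (H := H) blk d s δ₀ δ α β ρ Λ κQ cF cV κC BG BG3 BD BE BE3 Bc Bc' cB
    (cC + ∑ k ∈ s, cMk k) α₁ cBk hκQ hcF hcV hκC hBG hBG3 hBD hBE hBE3 hBc hBc' hcB (add_nonneg hcC hSM) hα₁ hΛ hρ hα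
    hβ hδ₀ hr hcBk hsum hdnn htri hlen h261 hT1 hT1i hT2i hT4 h357 h357s h365 hC hV hG hDG hGD hEDs hVE hV1 hCpp hQ hQs
    hF hFs hCinv hCinv' hCp

end Literature.MathematicalPhysics.QuantumFieldTheory.Balaban1983to89.B9Ineq368CommSum
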